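import Summits.ValiantsHypothesis.ValiantsHypothesis.Theses.ProjectionStability
import Summits.ValiantsHypothesis.ValiantsHypothesis.Theorems.ProjectionStabilityUniqBaseRefutation

/-!
# Disproof of `UniqBase` (stmt-ValiantsHypothesis-17836) — findings: CRUX IS DEAD (refuted in tree)

Status at this seat's start (2026-08-17T12:27Z): the crux was already CLOSED `refuted`
(refuted-substantive) at 12:22:21Z by the accepted proposal p160138 @53947f98e527,
`Summit.ValiantsHypothesis.ValiantsHypothesis.Theorems.not_UniqBase`
(file `Theorems/ProjectionStabilityUniqBaseRefutation.lean`), landed by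
prover-line-stmt-ValiantsHypothesis-17836-0 from the ideators' `Cruxes/UniqBase/NotUniqBase.lean`.

* Witness (tree, `Theorems/ProjOptimalUnique/Negative/PurifiedTwist.lean`,
  `exists_grenet_purifiedTwist`): Grenet's 7×7 projection `gA` of per₃ versus its purified
  single-syzygy Koszul twist `K` (constants 0, ±1), two optimal pure projections of DET with
  det = per₃ in different `GL₇(ℂ)² × permSymmetrySubst ℂ 3 × ᵀ` classes
  (`Theorems.not_ProjOptimalUniqueThree`), transported along `pdc(per₃) = 7`
  (`detProjectionComplexity_perPoly_three`).
* Class: refuted-substantive (route's own kill criterion "a second orbit of 7×7 projections of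
  per₃" met verbatim; no side condition exploited).
* Why no cheap repair (from the refutation docstring and `Cruxes/UniqBase/NOTES.md` §2–§3, which
  this seat read and does not duplicate): the twist is a row syzygy of Grenet_n at every n (moving
  the base to n₀ = 4 is uncertifiable while pdc(per₄) is open, and not visibly sporadic);
  uniqueness modulo POLYNOMIAL gauge is vacuous (ℂ[x]/(per₃) factorial, kit j025691).
* This seat (cdisprove, cycle 1) therefore ran NO new attack: there is no live statement to
  attack, and negative lemmas about not-yet-filed restatements would be out of cone
  (anti-leakage).  If the planner restates `UniqBase` within the 72 h grace, a re-armed disprover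
  should start from `Cruxes/UniqBase/NOTES.md` §3 (repair menu) and the memo
  `memo-UniqBase.md` (flag-space invariant R2, cell-pairing identity) attached to the item.
-/

-- single-conjunct layout: Sub = Summit, duplicated namespace component intended
set_option linter.dupNamespace false

namespace Summit.ValiantsHypothesis.ValiantsHypothesis.Cruxes.UniqBase.Disproof

open Summit.ValiantsHypothesis.ValiantsHypothesis

/-- The crux is dead: re-export of the tree's accepted refutation (p160138), so that every reader
of this work file has the kill one `exact` away. -/
theorem uniqBase_refuted : ¬ Theses.ProjectionStability.UniqBase :=
  Theorems.not_UniqBase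

end Summit.ValiantsHypothesis.ValiantsHypothesis.Cruxes.UniqBase.Disproof
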